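import Literature.Probability.Percolation.SlabAnnulusCircuits
import HarnessLib

/-!
# Newman–Tassion–Wu 2017, §3.3 (Theorem 3.10): extracting a surrounding open circuit from a
# closed open walk with nonzero winding number

Topic: `Literature/Probability/Percolation`. First file of the port of THEOREM 3.10 of
Newman–Tassion–Wu, *Critical percolation and the minimal spanning tree in slabs* (CPAM 70 (2017);
arXiv:1512.09107): "`f_p(2n,n-1) ≥ c ⟹ P_p[𝒜_{λn,2λn}] ≥ c'`, where `𝒜_{ℓ,2ℓ}` is the event that
there exists inside `Ā_{ℓ,2ℓ}` an open circuit surrounding `B̄_ℓ`" (p. 12 of the arXiv text).  In the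
proof the circuit is never written down: one shows that certain open paths, glued at the corners of
the annulus and linked through unique crossing clusters, "would imply the existence of a circuit in
`Ā_{λn,λn+n}`" (p. 14).  In the tree's vocabulary (`SlabAnnulusCircuits.lean`) a surrounding circuit
is an `NTW17.IsOpenCircuit` (a CLOSED SELF-AVOIDING open vertex list) whose projection has nonzero
winding number (`NTW17.Surrounds`, via `NTW17.seqWinding`), so the step "closed open walk that goes
once around ⟹ surrounding open circuit" has real content.  This file supplies it, once, in the
abstract:

* `NTW17.pathWinding u L` — the winding of an OPEN vertex list (the non-cyclic part of
  `seqWinding`): `seqWinding u L = pathWinding u L + stepWinding u L.last L.head`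
  (`seqWinding_eq_pathWinding_add`); additivity under concatenation (`pathWinding_cons_append_cons`,
  `pathWinding_append_of_head_eq`).
* `NTW17.seqWinding_split` — cutting a closed vertex sequence at a repeated vertex splits its winding
  number: `seqWinding u (P ++ x :: Q ++ x :: R) = seqWinding u (x :: Q) + seqWinding u (P ++ x :: R)`.
* **`NTW17.exists_isOpenCircuit_of_closed`** — a closed `ω`-open walk inside `A` (consecutive
  vertices distinct and joined by open edges, last joined to first) whose projection has nonzero
  winding number about `u` contains an `ω`-open circuit inside `A` with nonzero winding number about
  `u` (strong induction on the length: a walk without repetition is a circuit; otherwise cut at a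
  repeated vertex, one of the two closed pieces keeps a nonzero winding number).
* `NTW17.exists_isOpenCircuit_of_loop` — the same for a "looped" list (first vertex = last vertex),
  with `pathWinding` in place of `seqWinding`.
* **`NTW17.circuitAround_of_loop`** — in the annulus `Ā_{m,n}(c)`: a looped `ω`-open walk inside
  `Ā_{m,n}(c)` with `pathWinding (ts c) ≠ 0` puts `ω` in `circuitAround k c m n`.

No lattice structure is used (the statements are about `stepWinding` of arbitrary consecutive
projections), so they apply verbatim to the lazy planar shadows of slab paths.

## Sources

* C. M. Newman, V. Tassion, W. Wu, *Critical percolation and the minimal spanning tree in slabs*,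
  Comm. Pure Appl. Math. 70 (2017) 2084–2120, arXiv:1512.09107: §3.2 (circuits surrounding the
  origin, p. 11), Theorem 3.10 and its proof (pp. 12–14: "would imply the existence of a circuit")
  [NewmanTassionWu2017].
* H. Kesten, *Percolation theory for mathematicians*, Birkhäuser 1982, §2.2 (winding numbers of
  lattice circuits; the tree's `PlanarDuality.lean`, `stepWinding`) [KestenPTM1982].
-/

noncomputable section

namespace Literature.Probability.Percolation

open LatticeModels

namespace NTW17

/-! ## The winding of an open vertex list -/

/-- **The winding of an open planar vertex list** about `u + (½,½)`: the sum of the tree's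
`stepWinding u` over consecutive pairs (no closing step).  For a closed sequence,
`seqWinding = pathWinding + (closing step)` (`seqWinding_eq_pathWinding_add`).
[cite: KestenPTM1982, §2.2] -/
def pathWinding (u : Site 2) : List (Site 2) → ℤ
  | [] => 0
  | [_] => 0
  | a :: b :: t => stepWinding u a b + pathWinding u (b :: t)

/-- `pathWinding` of the empty list. [cite: KestenPTM1982, §2.2] -/
@[simp] theorem pathWinding_nil (u : Site 2) : pathWinding u [] = 0 := rfl

/-- `pathWinding` of a single point. [cite: KestenPTM1982, §2.2] -/
@[simp] theorem pathWinding_singleton (u a : Site 2) : pathWinding u [a] = 0 := rfl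

/-- `pathWinding` peels off its first step. [cite: KestenPTM1982, §2.2] -/
@[simp] theorem pathWinding_cons_cons (u a b : Site 2) (t : List (Site 2)) :
    pathWinding u (a :: b :: t) = stepWinding u a b + pathWinding u (b :: t) := rfl

/-- A step from a point to itself does not wind. [cite: KestenPTM1982, §2.2] -/
@[simp] theorem stepWinding_self (u a : Site 2) : stepWinding u a a = 0 := by
  unfold stepWinding upStep
  split_ifs <;> omega

/-- `pathWinding` is the lazy `zip` sum appearing in the definition of `seqWinding`.
[cite: KestenPTM1982, §2.2] -/
theorem pathWinding_eq_zip_sum (u : Site 2) :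
    ∀ (a : Site 2) (t : List (Site 2)),
      pathWinding u (a :: t) = (((a :: t).zip t).map fun q => stepWinding u q.1 q.2).sum := by
  intro a t
  induction t generalizing a with
  | nil => simp
  | cons b t ih => simp [ih b]

/-- **`seqWinding = pathWinding + closing step`.** [cite: KestenPTM1982, §2.2] -/
theorem seqWinding_eq_pathWinding_add (u : Site 2) (a : Site 2) (t : List (Site 2)) :
    seqWinding u (a :: t) =
      pathWinding u (a :: t) + stepWinding u ((a :: t).getLast (List.cons_ne_nil a t)) a := by
  rw [seqWinding, pathWinding_eq_zip_sum]

/-- **Additivity of `pathWinding` under concatenation** (with the junction step).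
[cite: KestenPTM1982, §2.2] -/
theorem pathWinding_cons_append_cons (u : Site 2) :
    ∀ (a : Site 2) (P : List (Site 2)) (b : Site 2) (Q : List (Site 2)),
      pathWinding u (a :: (P ++ b :: Q)) =
        pathWinding u (a :: P) + stepWinding u ((a :: P).getLast (List.cons_ne_nil a P)) b +
          pathWinding u (b :: Q) := by
  intro a P
  induction P generalizing a with
  | nil => intro b Q; simp
  | cons c P ih =>
    intro b Q
    rw [List.cons_append, pathWinding_cons_cons, ih c b Q, pathWinding_cons_cons, List.getLast_cons_cons]
    ring

/-- Additivity of `pathWinding` for two lists overlapping in one point: if `M` starts where `L`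
ends then `pathWinding (L ++ M.tail) = pathWinding L + pathWinding M`. [cite: KestenPTM1982, §2.2] -/
theorem pathWinding_append_of_head_eq (u : Site 2) {L M : List (Site 2)} (hL : L ≠ []) (hM : M ≠ [])
    (h : M.head hM = L.getLast hL) :
    pathWinding u (L ++ M.tail) = pathWinding u L + pathWinding u M := by
  obtain ⟨a, P, rfl⟩ := List.exists_cons_of_ne_nil hL
  obtain ⟨b, Q, rfl⟩ := List.exists_cons_of_ne_nil hM
  simp only [List.head_cons] at h
  cases Q with
  | nil => simp
  | cons c Q =>
    rw [List.tail_cons, List.cons_append, pathWinding_cons_append_cons, pathWinding_cons_cons, h]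
    ring

/-- **Cutting a closed sequence at a repeated point splits its winding number**:
`seqWinding u (P ++ x :: Q ++ x :: R) = seqWinding u (x :: Q) + seqWinding u (P ++ x :: R)`.
[cite: KestenPTM1982, §2.2] -/
theorem seqWinding_split (u : Site 2) (P : List (Site 2)) (x : Site 2) (Q R : List (Site 2)) :
    seqWinding u (P ++ x :: (Q ++ x :: R)) = seqWinding u (x :: Q) + seqWinding u (P ++ x :: R) := by
  cases P with
  | nil =>
    rw [List.nil_append, List.nil_append, seqWinding_eq_pathWinding_add, seqWinding_eq_pathWinding_add,
      seqWinding_eq_pathWinding_add, pathWinding_cons_append_cons]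
    have h1 : (x :: (Q ++ x :: R)).getLast (List.cons_ne_nil _ _) = (x :: R).getLast (List.cons_ne_nil _ _) := by
      simp [List.getLast_append_of_ne_nil]
    rw [h1]
    ring
  | cons p P =>
    rw [List.cons_append, List.cons_append, seqWinding_eq_pathWinding_add, seqWinding_eq_pathWinding_add,
      seqWinding_eq_pathWinding_add, pathWinding_cons_append_cons, pathWinding_cons_append_cons,
      pathWinding_cons_append_cons]
    have h1 : (p :: (P ++ x :: (Q ++ x :: R))).getLast (List.cons_ne_nil _ _) =
        (x :: R).getLast (List.cons_ne_nil _ _) := by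
      simp [List.getLast_append_of_ne_nil]
    have h2 : (p :: (P ++ x :: R)).getLast (List.cons_ne_nil _ _) = (x :: R).getLast (List.cons_ne_nil _ _) := by
      simp [List.getLast_append_of_ne_nil]
    rw [h1, h2]
    ring

/-! ## Lists with a repetition -/

/-- A list that is not duplicate-free splits at two occurrences of one of its entries (used to cut
a closed walk at a repeated vertex). [cite: KestenPTM1982, §2.2] -/
theorem exists_split_of_not_nodup {α : Type*} :
    ∀ {l : List α}, ¬l.Nodup → ∃ (x : α) (P Q R : List α), l = P ++ x :: (Q ++ x :: R) := by
  intro l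
  induction l with
  | nil => intro h; simp at h
  | cons a t ih =>
    intro h
    rw [List.nodup_cons, not_and_or, not_not] at h
    rcases h with ha | ht
    · obtain ⟨Q, R, rfl⟩ := List.append_of_mem ha
      exact ⟨a, [], Q, R, by simp⟩
    · obtain ⟨x, P, Q, R, rfl⟩ := ih ht
      exact ⟨x, a :: P, Q, R, by simp⟩

/-! ## Extracting a circuit from a closed open walk -/

section Extraction

variable {k : ℕ}

/-- **A closed open walk with nonzero winding number contains a surrounding open circuit.**  If
`W` is a non-empty list of vertices of `A ⊆ S_k` whose consecutive vertices are distinct and joined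
by `ω`-open edges, whose last vertex is distinct from and joined by an open edge to the first, and
whose projection has nonzero winding number about `u + (½,½)`, then some `ω`-open circuit inside
`A` (an `IsOpenCircuit`: closed and SELF-AVOIDING) has nonzero winding number about `u + (½,½)`.
Proof: strong induction on the length; a walk without repeated vertices is a circuit; otherwise cut
it at two occurrences of a vertex into two shorter closed walks — their winding numbers add up to
that of `W` (`seqWinding_split`), so one of them is nonzero.
[cite: NewmanTassionWu2017, Theorem 3.10 (proof, "would imply the existence of a circuit in Ā")] -/
theorem exists_isOpenCircuit_of_closed (u : Site 2) {ω : BondConfig (slab 3 k)} {A : Set (slab 3 k)} :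
    ∀ (n : ℕ) (W : List (slab 3 k)) (hW : W ≠ []), W.length ≤ n →
      W.IsChain (fun a b => s(a, b) ∈ ω ∧ a ≠ b) → (∀ x ∈ W, x ∈ A) →
      (s(W.getLast hW, W.head hW) ∈ ω ∧ W.getLast hW ≠ W.head hW) →
      seqWinding u (W.map (proj k)) ≠ 0 →
      ∃ l, IsOpenCircuit k ω A l ∧ seqWinding u (l.map (proj k)) ≠ 0 := by
  intro n
  induction n with
  | zero =>
    intro W hW hlen
    exact absurd (List.eq_nil_of_length_eq_zero (Nat.le_zero.1 hlen)) hW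
  | succ n ih =>
    intro W hW hlen hch hA hcl hwind
    by_cases hnd : W.Nodup
    · exact ⟨W, ⟨hnd, hch, hA, hW, fun _ => hcl⟩, hwind⟩
    · obtain ⟨x, P, Q, R, rfl⟩ := exists_split_of_not_nodup hnd
      -- the winding number splits
      have hsplit : seqWinding u ((P ++ x :: (Q ++ x :: R)).map (proj k)) =
          seqWinding u ((x :: Q).map (proj k)) + seqWinding u ((P ++ x :: R).map (proj k)) := by
        simp only [List.map_append, List.map_cons]
        exact seqWinding_split u _ _ _ _
      rw [hsplit] at hwind
      -- regrouping `W = (P ++ x :: Q) ++ x :: R`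
      have e1 : P ++ x :: (Q ++ x :: R) = (P ++ x :: Q) ++ x :: R := by simp
      have hch' : ((P ++ x :: Q) ++ x :: R).IsChain (fun a b => s(a, b) ∈ ω ∧ a ≠ b) := e1 ▸ hch
      -- the first piece `x :: Q`
      have hch1 : (x :: Q).IsChain (fun a b => s(a, b) ∈ ω ∧ a ≠ b) :=
        hch'.left_of_append.right_of_append
      have hcl1 : s((x :: Q).getLast (List.cons_ne_nil x Q), (x :: Q).head (List.cons_ne_nil x Q)) ∈ ω ∧
          (x :: Q).getLast (List.cons_ne_nil x Q) ≠ (x :: Q).head (List.cons_ne_nil x Q) := by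
        have h := hch'.rel_getLast_head_of_append (by simp : P ++ x :: Q ≠ []) (List.cons_ne_nil x R)
        rw [List.getLast_append_of_ne_nil _ (List.cons_ne_nil x Q)] at h
        simpa using h
      have hA1 : ∀ y ∈ x :: Q, y ∈ A := fun y hy => hA y (by
        simp only [List.mem_append, List.mem_cons] at hy ⊢; tauto)
      have hlen1 : (x :: Q).length ≤ n := by
        simp only [List.length_append, List.length_cons] at hlen ⊢; omega
      -- the second piece `P ++ x :: R`
      have hne2 : P ++ x :: R ≠ [] := by simp
      have hch2 : (P ++ x :: R).IsChain (fun a b => s(a, b) ∈ ω ∧ a ≠ b) := by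
        refine List.IsChain.append hch'.left_of_append.left_of_append hch'.right_of_append ?_
        intro a ha b hb
        have hx : b = x := by simpa using hb.symm
        subst hx
        exact (List.isChain_append.1 hch).2.2 a ha b (by simp)
      have hA2 : ∀ y ∈ P ++ x :: R, y ∈ A := fun y hy => hA y (by
        simp only [List.mem_append, List.mem_cons] at hy ⊢; tauto)
      have hcl2 : s((P ++ x :: R).getLast hne2, (P ++ x :: R).head hne2) ∈ ω ∧
          (P ++ x :: R).getLast hne2 ≠ (P ++ x :: R).head hne2 := by
        have hl : (P ++ x :: R).getLast hne2 = (P ++ x :: (Q ++ x :: R)).getLast hW := by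
          simp [List.getLast_append_of_ne_nil]
        have hh : (P ++ x :: R).head hne2 = (P ++ x :: (Q ++ x :: R)).head hW := by
          cases P <;> simp
        rw [hl, hh]; exact hcl
      have hlen2 : (P ++ x :: R).length ≤ n := by
        simp only [List.length_append, List.length_cons] at hlen ⊢; omega
      -- one of the two pieces winds
      by_cases h1 : seqWinding u ((x :: Q).map (proj k)) = 0
      · have h2 : seqWinding u ((P ++ x :: R).map (proj k)) ≠ 0 := by
          rw [h1, zero_add] at hwind; exact hwind
        exact ih (P ++ x :: R) hne2 hlen2 hch2 hA2 hcl2 h2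
      · exact ih (x :: Q) (List.cons_ne_nil x Q) hlen1 hch1 hA1 hcl1 h1

/-- **Looped form.**  If `L` is an `ω`-open walk inside `A` (consecutive vertices distinct and
joined by open edges) which returns to its starting vertex (`L.head = L.getLast`) and whose
projection has `pathWinding u ≠ 0`, then some `ω`-open circuit inside `A` has nonzero winding
number about `u + (½,½)`. [cite: NewmanTassionWu2017, Theorem 3.10 (proof, "would imply the existence of a circuit in Ā")] -/
theorem exists_isOpenCircuit_of_loop (u : Site 2) {ω : BondConfig (slab 3 k)} {A : Set (slab 3 k)}
    {L : List (slab 3 k)} (hL : L ≠ []) (hch : L.IsChain (fun a b => s(a, b) ∈ ω ∧ a ≠ b))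
    (hA : ∀ x ∈ L, x ∈ A) (hloop : L.head hL = L.getLast hL)
    (hwind : pathWinding u (L.map (proj k)) ≠ 0) :
    ∃ l, IsOpenCircuit k ω A l ∧ seqWinding u (l.map (proj k)) ≠ 0 := by
  -- `L = M ++ [a]` with `a = L.getLast`, `M` non-empty and `M.head = a`
  have hLM : L = L.dropLast ++ [L.getLast hL] := (List.dropLast_append_getLast hL).symm
  have hMne : L.dropLast ≠ [] := by
    intro hM0
    rw [hM0, List.nil_append] at hLM
    rw [hLM] at hwind
    simp at hwind
  obtain ⟨m, M', hMeq⟩ := List.exists_cons_of_ne_nil hMne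
  rw [hMeq] at hLM
  have hm : m = L.getLast hL := by
    have h1 : L.head? = some m := by rw [hLM]; simp
    have h2 := List.head?_eq_some_head hL
    rw [h1, hloop] at h2
    exact (Option.some.inj h2)
  -- data of the closed walk `m :: M'`
  have hchL : ((m :: M') ++ [L.getLast hL]).IsChain (fun a b => s(a, b) ∈ ω ∧ a ≠ b) := hLM ▸ hch
  have hchM : (m :: M').IsChain (fun a b => s(a, b) ∈ ω ∧ a ≠ b) := hchL.left_of_append
  have hclM : s((m :: M').getLast (List.cons_ne_nil m M'), (m :: M').head (List.cons_ne_nil m M')) ∈ ω ∧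
      (m :: M').getLast (List.cons_ne_nil m M') ≠ (m :: M').head (List.cons_ne_nil m M') := by
    have := hchL.rel_getLast_head_of_append (List.cons_ne_nil m M') (List.cons_ne_nil _ [])
    simpa [hm] using this
  have hAM : ∀ x ∈ m :: M', x ∈ A := fun x hx => hA x (by rw [hLM]; exact List.mem_append_left _ hx)
  have hwM : seqWinding u ((m :: M').map (proj k)) ≠ 0 := by
    have hwind' : pathWinding u (((m :: M') ++ [L.getLast hL]).map (proj k)) ≠ 0 := by
      rw [← hLM]; exact hwind
    rw [← hm, List.cons_append, List.map_cons, List.map_append, List.map_cons, List.map_nil,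
      pathWinding_cons_append_cons, pathWinding_singleton, add_zero] at hwind'
    rw [List.map_cons, seqWinding_eq_pathWinding_add]
    exact hwind'
  exact exists_isOpenCircuit_of_closed u (m :: M').length (m :: M') (List.cons_ne_nil m M') le_rfl
    hchM hAM hclM hwM

/-- **From a looped open walk in an annulus to `circuitAround`.**  If `L` is an `ω`-open walk inside
`Ā_{m,n}(c)` returning to its starting vertex whose projection has `pathWinding (ts c) ≠ 0` (it
winds around `c + (½,½)`), then `ω ∈ 𝒜_{m,n}(c)` (`circuitAround k c m n`).
[cite: NewmanTassionWu2017, Theorem 3.10 (the event 𝒜_{ℓ,2ℓ}; proof p. 14)] -/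
theorem circuitAround_of_loop {ω : BondConfig (slab 3 k)} {c : ℤ × ℤ} {m n : ℕ}
    {L : List (slab 3 k)} (hL : L ≠ []) (hch : L.IsChain (fun a b => s(a, b) ∈ ω ∧ a ≠ b))
    (hA : ∀ x ∈ L, x ∈ slabLift k (annulus c m n)) (hloop : L.head hL = L.getLast hL)
    (hwind : pathWinding (ts c) (L.map (proj k)) ≠ 0) :
    ω ∈ circuitAround k c m n := by
  obtain ⟨l, hl, hw⟩ := exists_isOpenCircuit_of_loop (ts c) hL hch hA hloop hwind
  exact ⟨l, hl, hw⟩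

end Extraction

end NTW17

end Literature.Probability.Percolation

end
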